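import Summits.CriticalPhenomena.SAWScalingLimit.Theorems.SAWLoopFugacityFlowSimpleSubseqLimitsTransferCore
import Summits.CriticalPhenomena.SAWScalingLimit.Theorems.SAWLoopFugacityFlowSimpleSubseqLimitsRouteResidual
import HarnessLib.Audit

/-!
# Line `slit-continuous-restriction` — skeleton for the crux `SimpleSubseqLimits`
# (stmt-CriticalPhenomena-4982), lead c9, CLOSED MODULO THE OPEN INPUT (2026-08-17)

Idea card `Cruxes/SimpleSubseqLimits/Ideas/slit-continuous-restriction.md`; strategist skeleton
(seat s1); reshaped by the lead into seven registered stubs, of which SIX ARE LANDED (all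
`--supports stmt-CriticalPhenomena-4982`, axioms standard):

* `Lattice.stub_latticeBound` — p149500, `Theorems/SAWLoopFugacityFlowSimpleSubseqLimitsLatticeBound.lean`;
* `Timing.stub_prefixTiming` — p150768, `Theorems/…PrefixTiming.lean`;
* `Pasts.stub_pastsCompact` — p151879, `Theorems/…PastsCompact.lean`;
* `Arc.stub_subArc` — p151729, `Theorems/…SubArc.lean`;
* `Endpoints.stub_endpoints` — p151709, `Theorems/…Endpoints.lean`;
* `Transfer.stub_transferCore` — p153873, `Theorems/…TransferCore.lean` (with parts
  `…TransferLocal` p152831, `…TransferConf` p153003, `…TransferLattice` p153811).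

The vocabulary of the line (`farPast`, `IsAdmissiblePast`, `prefixEvent`, `approachEvent`,
`SequentialSlitAvoidance`, `OffTargetFarReturn`, `FarReturnNullOffTarget`, `FarReturnNull`,
`vertexTime`, `truncate`, `pastSet`, `LatticeBound`, `PrefixTiming`, `PastsCompact`, `SubArc`) now
lives in those landed files (verbatim the registered texts) and is imported here, so this skeleton
declares NOTHING but the one remaining stub:

* `stub_seqSlitAvoidance : SequentialSlitAvoidance` — OPEN (research): conditional first-entrance
  far-slit avoidance, pointwise and sequentially continuous in the admissible limit past; the
  value-free shadow of the A-side `AvoidanceLimit` (stmt-10649) made continuous along slit domains;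
  probed for mis-statement (evidence `SeqSlitAvoidance-probe.md`: typing survives every degenerate
  instance; its three structural clauses are load-bearing; literature delta 2021–2026 null).

Composition (kernel-checked, only `stub_seqSlitAvoidance` sorried): `SimpleSubseqLimits_of :
SequentialSlitAvoidance → AvoidanceLimit → SimpleSubseqLimits` concludes the crux BY NAME; the A-side
`AvoidanceLimit` is the route's own rank-2 crux stmt-10649, a co-hypothesis of every deciding theorem
consuming this crux (it supplies SHAPE through `RouteResidual.avoidanceValues_of_avoidanceLimit`).
Route-neutral form: `core_of_seqSlitAvoidance : SequentialSlitAvoidance → AvoidanceValues →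
Negative.SimpleSubseqLimitsCore`.
-/

noncomputable section

open MeasureTheory Filter Topology Set Metric Function
open Literature.Probability.RandomPlanarGeometry Literature.Probability.RandomPlanarGeometry.SAW
open Literature.Probability.LatticeModels
open scoped ENNReal NNReal BoundedContinuousFunction unitInterval

namespace Summit.CriticalPhenomena.SAWScalingLimit.Cruxes.SimpleSubseqLimits.SlitContinuousRestriction

open Summit.CriticalPhenomena.SAWScalingLimit.Theses.SAWLoopFugacityFlow (SimpleSubseqLimits AvoidanceLimit)
open Summit.CriticalPhenomena.SAWScalingLimit.Theorems.SimpleSubseqLimits.Negative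
  (SimpleSubseqLimitsCore simpleSubseqLimits_iff_core ae_source_target_range_of_weakLimitAlong)
open Summit.CriticalPhenomena.SAWScalingLimit.Theorems.SimpleSubseqLimits.MarkedPointRevisit.Passage
  (IsSubseqLimit)
open Summit.CriticalPhenomena.SAWScalingLimit.Theorems.SimpleSubseqLimits.FirstHit.Passage
  (gaussRat countable_gaussRat)
open Summit.CriticalPhenomena.SAWScalingLimit.Theorems.SimpleSubseqLimits.FarPast.Passage
  (farReturnEvent mem_simple_of_forall_notMem_farReturnEvent)
open Summit.CriticalPhenomena.SAWScalingLimit.Theorems.SimpleSubseqLimits.PastShadowing.Main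
  (AvoidanceValues rangeArc_of_avoidanceValues)
open Summit.CriticalPhenomena.SAWScalingLimit.Theorems.SimpleSubseqLimits.FarPast.RouteResidual
  (avoidanceValues_of_avoidanceLimit)
open Summit.CriticalPhenomena.SAWScalingLimit.Theorems.SimpleSubseqLimits.SlitRestriction.Lattice
  (LatticeBound stub_latticeBound)
open Summit.CriticalPhenomena.SAWScalingLimit.Theorems.SimpleSubseqLimits.SlitRestriction.Timing
  (PrefixTiming stub_prefixTiming)
open Summit.CriticalPhenomena.SAWScalingLimit.Theorems.SimpleSubseqLimits.SlitRestriction.Pasts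
  (PastsCompact stub_pastsCompact)
open Summit.CriticalPhenomena.SAWScalingLimit.Theorems.SimpleSubseqLimits.SlitRestriction.Arc
  (SubArc stub_subArc)
open Summit.CriticalPhenomena.SAWScalingLimit.Theorems.SimpleSubseqLimits.SlitRestriction.Endpoints
  (FarReturnNullOffTarget FarReturnNull stub_endpoints)
open Summit.CriticalPhenomena.SAWScalingLimit.Theorems.SimpleSubseqLimits.SlitRestriction.Transfer
  (SequentialSlitAvoidance stub_transferCore)

/-! ## The one remaining stub -/

/-- **stub 1 — SEQUENTIAL SLIT AVOIDANCE** (OPEN; the engine-facing input: conditional first-entrance far-slit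
avoidance, pointwise and sequentially continuous in the limit past). -/
theorem stub_seqSlitAvoidance : SequentialSlitAvoidance := by
  sorry

/-! ## Glue (proved): far-return nullity + SHAPE give the core of the crux -/

/-- **Far-return nullity and the hull-avoidance values of subsequential limits give the CORE of the crux**
(`Negative.SimpleSubseqLimitsCore`: `ν`-a.e. simple ∧ boundary clause; the crux itself is
`Negative.simpleSubseqLimits_iff_core`). Simplicity `ν`-a.e.: the countably many far-return events with
Gaussian-rational centre and positive rational radius are null, endpoints `a ≠ b` are free
(`Negative.ae_source_target_range_of_weakLimitAlong`), and the guarded Rohde–Schramm closing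
`FarPast.Passage.mem_simple_of_forall_notMem_farReturnEvent` applies; the boundary clause `ν`-a.e. from SHAPE
(`PastShadowing.Main.rangeArc_of_avoidanceValues`). [folklore] -/
theorem core_of_farReturnNull (hN : FarReturnNull) (hAV : AvoidanceValues) : SimpleSubseqLimitsCore := by
  intro D a b hab s ν hs hν hw
  haveI := hν
  have hL : IsSubseqLimit D a b s ν := ⟨hs, hν, hw⟩
  have hfree := ae_source_target_range_of_weakLimitAlong (ν := ν) hab hs hw
  haveI : Countable gaussRat := countable_gaussRat.to_subtype
  have hnull : ∀ᵐ c ∂ν, ∀ q : gaussRat, ∀ r : {x : ℚ // 0 < x},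
      c ∉ farReturnEvent (q : ℂ) (r : ℚ) := by
    rw [ae_all_iff]; intro q
    rw [ae_all_iff]; intro r
    have hr : (0 : ℝ) < ((r : ℚ) : ℝ) := by exact_mod_cast r.2
    exact measure_eq_zero_iff_ae_notMem.1 (hN D a b s ν hab hL q _ hr)
  have hshape := rangeArc_of_avoidanceValues hAV D a b hab s ν hs hν hw
  filter_upwards [hfree, hnull, hshape] with c hc hn h2
  refine ⟨mem_simple_of_forall_notMem_farReturnEvent c (fun q hq r hr => ?_) ?_, h2.2⟩
  · exact hn ⟨q, hq⟩ ⟨r, hr⟩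
  · rw [hc.1, hc.2.1]
    exact fun h => absurd (D.pt_injective h) (by decide)

/-! ## Composition -/

/-- **Route-neutral form**: sequential slit avoidance and the hull-avoidance values of subsequential limits
give the CORE of the crux (SIX LANDED STUBS: `stub_latticeBound`, `stub_prefixTiming`,
`stub_pastsCompact`, `stub_subArc`, `stub_transferCore`, `stub_endpoints`). [folklore] -/
theorem core_of_seqSlitAvoidance (h₁ : SequentialSlitAvoidance) (hAV : AvoidanceValues) :
    SimpleSubseqLimitsCore :=
  core_of_farReturnNull (stub_endpoints (stub_transferCore stub_latticeBound stub_prefixTiming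
    stub_pastsCompact stub_subArc h₁ hAV)) hAV

/-- **The line concludes the crux BY NAME** from sequential slit avoidance and the route's A-side crux
`AvoidanceLimit` (stmt-CriticalPhenomena-10649). [folklore] -/
theorem SimpleSubseqLimits_of (h₁ : SequentialSlitAvoidance) (hA : AvoidanceLimit) : SimpleSubseqLimits :=
  simpleSubseqLimits_iff_core.2 (core_of_seqSlitAvoidance h₁ (avoidanceValues_of_avoidanceLimit hA))

/-- Wiring check: the crux from the one remaining stub and the A-side crux. -/
theorem SimpleSubseqLimits_proof (hA : AvoidanceLimit) : SimpleSubseqLimits :=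
  SimpleSubseqLimits_of stub_seqSlitAvoidance hA

end Summit.CriticalPhenomena.SAWScalingLimit.Cruxes.SimpleSubseqLimits.SlitContinuousRestriction

end
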